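import Mathlib
import HarnessLib
import Summits.HubbardSuperconductivity.HubbardSuperconductivity.Theorems.KLProgrammeKLRegimeVolumeLimitSecondOrderEval
import Summits.HubbardSuperconductivity.HubbardSuperconductivity.Theorems.KLProgrammeKLRegimeVolumeLimitSecondOrderSunsetId
import Summits.HubbardSuperconductivity.HubbardSuperconductivity.Theorems.KLProgrammeKLRegimeVolumeLimitHartreeLimit
import Summits.HubbardSuperconductivity.HubbardSuperconductivity.Theorems.KLProgrammeKLRegimeVolumeLimitAlgebra

/-!
# Child `KLRegimeVolumeLimit` (stmt-HubbardSuperconductivity-19665 / its gen-3 twin) — the ORDER-`U²` RUNG of the TRUE carrier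
# satisfies the volume-limit text (seat hubbard-kl-k3c5-p3)

By `…SecondOrderEval`, `S₂(L,M;k,σ) := d²/dU²|₀ klSelfEnergy L M β U μ K klE0 (nScales β + 1) (k,σ)
= 2 (ĝ₀(k)/ĝ_K(k))² ((βL²)⁻² Sun(k) − ĝ₀(k) A² − A·A₂)` with the sunset average `(βL²)⁻² Sun = klSunset ∘ (bare symbol)`
(`…SecondOrderSunsetId`), the tadpole average `A = (βL²)⁻¹ Σ_q ĝ₀(q)` and the one-loop average `A₂ = (βL²)⁻¹ Σ_q ĝ₀(q)²`.  Here: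

* `§1` scalar volume families converging «eventually in `L`, then in `M`»: bounded limits, products, and the embedding as
  momentum-constant families into the VL-clause algebra of `…VolumeLimitAlgebra` (seat k3c5-p2);
* `§2` the two one-loop averages converge in that sense: `A` by child 4's `stub_asm_free` at the bare frame and coincident points (as in
  `…VolumeLimitHartreeLimit`), `A₂` by the iterated Tannery lemma of `…TwoPointAssemblyIteratedTannery` over the moving Matsubara window
  (domination `(β/2π)²/|n+½|²`, per-integer Riemann sums `momentumAverage_approx_allSides`);
* `§3` **`secondOrder_volLimit`**: for every `β > 0`, `μ`, frame `K` and thresholds `Mstar`, the family `S₂` satisfies the three clauses of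
  `FinalTwoLegVolLimit` verbatim — a momentum-continuous limit per Matsubara integer, a volume-uniform bound, grid convergence eventually
  in `L` then in `M` — assembled from k3c4-p1's model-free sunset rung (`sunsetSum_volLimit`), `§2`, and the grid-exact frame dressings
  `(ĝ₀/ĝ_K)²`, `(ĝ₀/ĝ_K)² ĝ₀` by `volLimitShape_dressing_mul/_add`.

This is the first rung at which the volume limit of the true carrier is momentum-DEPENDENT and non-trivial (two loops); with k3c5-p2's
`firstOrderTaylor_volLimit` it gives the degree-two Taylor truncation of the carrier the VL clauses at every `U` (sequel
`…SecondOrderTaylorTwo`).  Everything is proved; no definition.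
-/

noncomputable section

namespace Summit.HubbardSuperconductivity.HubbardSuperconductivity.Theorems.TwoPointAssembly

set_option linter.dupNamespace false -- summit = problem name (single-conjunct summit), D-0017

open Finset Filter Topology Literature.MathematicalPhysics.QuantumLattice Literature.Probability.LatticeModels GrassmannAlgebra
open Summit.HubbardSuperconductivity.HubbardSuperconductivity.Theorems.KLRegimeSplit
open Summit.HubbardSuperconductivity.HubbardSuperconductivity.Theorems.KLProgrammeLegKernels

/-! ## §1 Scalar volume families: bounded iterated limits and products -/

/-- The iterated limit of a bounded scalar volume family is bounded by the same constant. -/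
theorem norm_le_of_iterLimit {a : ∀ (L M : ℕ) [NeZero L] [NeZero M], ℂ} {aInf : ℂ} {A : ℝ}
    (hb : ∀ (L : ℕ) [NeZero L] (M : ℕ) [NeZero M], ‖a L M‖ ≤ A)
    (hl : ∀ ε : ℝ, 0 < ε → ∃ L₁ : ℕ, ∀ (L : ℕ) [NeZero L], L₁ ≤ L →
      ∃ M₁ : ℕ, ∀ (M : ℕ) [NeZero M], M₁ ≤ M → ‖a L M - aInf‖ ≤ ε) :
    ‖aInf‖ ≤ A := by
  refine le_of_forall_pos_le_add fun ε hε => ?_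
  obtain ⟨L₁, hL₁⟩ := hl ε hε
  haveI : NeZero (L₁ + 1) := ⟨by omega⟩
  obtain ⟨M₁, hM₁⟩ := hL₁ (L₁ + 1) (by omega)
  haveI : NeZero (M₁ + 1) := ⟨by omega⟩
  have h := hM₁ (M₁ + 1) (by omega)
  calc ‖aInf‖ = ‖a (L₁ + 1) (M₁ + 1) - (a (L₁ + 1) (M₁ + 1) - aInf)‖ := by rw [sub_sub_cancel]
    _ ≤ ‖a (L₁ + 1) (M₁ + 1)‖ + ‖a (L₁ + 1) (M₁ + 1) - aInf‖ := norm_sub_le _ _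
    _ ≤ A + ε := add_le_add (hb _ _) h

/-- **Product rule for scalar volume families**: bounded iterated limits multiply. -/
theorem iterLimit_mul {a b : ∀ (L M : ℕ) [NeZero L] [NeZero M], ℂ} {aInf bInf : ℂ} {A B : ℝ} (hA : 0 ≤ A)
    (hba : ∀ (L : ℕ) [NeZero L] (M : ℕ) [NeZero M], ‖a L M‖ ≤ A)
    (hla : ∀ ε : ℝ, 0 < ε → ∃ L₁ : ℕ, ∀ (L : ℕ) [NeZero L], L₁ ≤ L →
      ∃ M₁ : ℕ, ∀ (M : ℕ) [NeZero M], M₁ ≤ M → ‖a L M - aInf‖ ≤ ε)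
    (hbb : ∀ (L : ℕ) [NeZero L] (M : ℕ) [NeZero M], ‖b L M‖ ≤ B)
    (hlb : ∀ ε : ℝ, 0 < ε → ∃ L₁ : ℕ, ∀ (L : ℕ) [NeZero L], L₁ ≤ L →
      ∃ M₁ : ℕ, ∀ (M : ℕ) [NeZero M], M₁ ≤ M → ‖b L M - bInf‖ ≤ ε) :
    (∀ (L : ℕ) [NeZero L] (M : ℕ) [NeZero M], ‖a L M * b L M‖ ≤ A * B) ∧
    (∀ ε : ℝ, 0 < ε → ∃ L₁ : ℕ, ∀ (L : ℕ) [NeZero L], L₁ ≤ L →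
      ∃ M₁ : ℕ, ∀ (M : ℕ) [NeZero M], M₁ ≤ M → ‖a L M * b L M - aInf * bInf‖ ≤ ε) := by
  have hBinf : ‖bInf‖ ≤ B := norm_le_of_iterLimit hbb hlb
  have hB : 0 ≤ B := (norm_nonneg _).trans hBinf
  refine ⟨fun L _ M _ => by rw [norm_mul]; exact mul_le_mul (hba L M) (hbb L M) (norm_nonneg _) hA, ?_⟩
  intro ε hε
  obtain ⟨La, hLa⟩ := hla (ε / 2 / (B + 1)) (by positivity)
  obtain ⟨Lb, hLb⟩ := hlb (ε / 2 / (A + 1)) (by positivity)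
  refine ⟨max La Lb, fun L _ hL => ?_⟩
  obtain ⟨Ma, hMa⟩ := hLa L (le_trans (le_max_left _ _) hL)
  obtain ⟨Mb, hMb⟩ := hLb L (le_trans (le_max_right _ _) hL)
  refine ⟨max Ma Mb, fun M _ hM => ?_⟩
  have h1 := hMa M (le_trans (le_max_left _ _) hM)
  have h2 := hMb M (le_trans (le_max_right _ _) hM)
  calc ‖a L M * b L M - aInf * bInf‖ = ‖a L M * (b L M - bInf) + (a L M - aInf) * bInf‖ := by ring_nf
    _ ≤ ‖a L M‖ * ‖b L M - bInf‖ + ‖a L M - aInf‖ * ‖bInf‖ := by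
        refine (norm_add_le _ _).trans ?_
        rw [norm_mul, norm_mul]
    _ ≤ A * (ε / 2 / (A + 1)) + ε / 2 / (B + 1) * B :=
        add_le_add (mul_le_mul (hba L M) h2 (norm_nonneg _) hA) (mul_le_mul h1 hBinf (norm_nonneg _) (by positivity))
    _ ≤ ε / 2 + ε / 2 := by
        gcongr
        · rw [mul_div_assoc']
          rw [div_le_iff₀ (by positivity)]
          nlinarith
        · rw [div_mul_eq_mul_div, div_le_iff₀ (by positivity)]
          nlinarith
    _ = ε := by ring

/-- **A scalar volume family as a momentum-constant grid family**: the three VL clauses with constant limit function. -/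
theorem volLimitShape_of_scalar {a : ∀ (L M : ℕ) [NeZero L] [NeZero M], ℂ} {aInf : ℂ} {A : ℝ} (Mstar : ℕ → ℕ)
    (hb : ∀ (L : ℕ) [NeZero L] (M : ℕ) [NeZero M], ‖a L M‖ ≤ A)
    (hl : ∀ ε : ℝ, 0 < ε → ∃ L₁ : ℕ, ∀ (L : ℕ) [NeZero L], L₁ ≤ L →
      ∃ M₁ : ℕ, ∀ (M : ℕ) [NeZero M], M₁ ≤ M → ‖a L M - aInf‖ ≤ ε) :
    (∀ (_n : ℤ) (_σ : Fin 2), Continuous fun _p : Fin 2 → ℝ => aInf) ∧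
    (∀ (L : ℕ) [NeZero L], 0 ≤ L → ∀ (M : ℕ) [NeZero M], Mstar L ≤ M →
      ∀ (_k : FreqMomentum L M) (_σ : Fin 2), ‖a L M‖ ≤ A) ∧
    (∀ (_n : ℤ) (_σ : Fin 2) (ε : ℝ), 0 < ε → ∃ L₁ : ℕ, ∀ (L : ℕ) [NeZero L], L₁ ≤ L →
      ∃ M₁ : ℕ, ∀ (M : ℕ) [NeZero M], M₁ ≤ M → ∀ ω : MatsubaraIdx M, matsubaraInt M ω = _n →
        ∀ _k : TorusSite 2 L, ‖a L M - aInf‖ ≤ ε) := by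
  refine ⟨fun _ _ => continuous_const, fun L _ _ M _ _ _ _ => hb L M, fun n σ ε hε => ?_⟩
  obtain ⟨L₁, hL₁⟩ := hl ε hε
  refine ⟨L₁, fun L _ hL => ?_⟩
  obtain ⟨M₁, hM₁⟩ := hL₁ L hL
  exact ⟨M₁, fun M _ hM _ _ _ => hM₁ M hM⟩

/-! ## §2 The two one-loop averages converge eventually in `L` then in `M` -/

/-- **The tadpole average converges**: `A_{L,M} = (βL²)⁻¹ Σ_q ĝ₀(q)` has an iterated limit (child 4's `stub_asm_free` at the bare frame and
coincident points; `A = −reprFree(K = 0, x̄ = ȳ)`). -/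
theorem tadpoleAvg_iterLimit {β : ℝ} (hβ : 0 < β) (μ : ℝ) :
    ∃ aInf : ℂ, ∀ ε : ℝ, 0 < ε → ∃ L₁ : ℕ, ∀ (L : ℕ) [NeZero L], L₁ ≤ L → ∃ M₁ : ℕ, ∀ (M : ℕ) [NeZero M], M₁ ≤ M →
      ‖(∑ q : FreqMomentum L M, propCT L M β μ 0 q) / ((β * (L : ℝ) ^ 2 : ℝ) : ℂ) - aInf‖ ≤ ε := by
  obtain ⟨fM, F, hM, hL⟩ := stub_asm_free β hβ μ 0 0 0 (0 : Site 2) (0 : Site 2)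
  refine ⟨-F, fun ε hε => ?_⟩
  obtain ⟨L₁, hL₁⟩ := Metric.tendsto_atTop.1 hL (ε / 2) (half_pos hε)
  refine ⟨max L₁ 3, fun L _ hLge => ?_⟩
  have hL3 : 3 ≤ L := le_trans (le_max_right _ _) hLge
  obtain ⟨M₁, hM₁⟩ := Metric.tendsto_atTop.1 (hM L hL3) (ε / 2) (half_pos hε)
  refine ⟨M₁, fun M _ hMge => ?_⟩
  rw [tadpoleAvg_eq_neg_reprFree β μ 0 (Torus.proj L (0 : Site 2)), sub_neg_eq_add, neg_add_eq_sub, norm_sub_rev]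
  have h1 := hM₁ M hMge
  have h2 := hL₁ L (le_trans (le_max_left _ _) hLge)
  rw [dist_eq_norm] at h1 h2
  calc ‖reprFree L M β μ 0 0 0 (Torus.proj L 0) (Torus.proj L 0) - F‖
      ≤ ‖reprFree L M β μ 0 0 0 (Torus.proj L 0) (Torus.proj L 0) - fM L‖ + ‖fM L - F‖ := norm_sub_le_norm_sub_add_norm_sub _ _ _
    _ ≤ ε / 2 + ε / 2 := add_le_add h1.le h2.le
    _ = ε := by ring

/-- `|n + ½| ≥ ½` for integers. -/
theorem half_le_abs_int_add_half (n : ℤ) : (1 / 2 : ℝ) ≤ |(n : ℝ) + 1 / 2| := by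
  have h := one_le_abs_two_mul_add_one n
  have h2 : |2 * (n : ℝ) + 1| = 2 * |(n : ℝ) + 1 / 2| := by
    rw [show (2 : ℝ) * n + 1 = 2 * ((n : ℝ) + 1 / 2) by ring, abs_mul, abs_of_pos (by norm_num : (0 : ℝ) < 2)]
  rw [h2] at h
  linarith

/-- The bare symbol is bounded by `β/π` uniformly in the label: `‖(ξ(x) − iω_a)⁻¹‖ ≤ β/π`. -/
theorem norm_bareSymbol_le {β : ℝ} (hβ : 0 < β) (μ : ℝ) (a : ℤ) (x : Fin 2 → ℝ) :
    ‖((bandCT μ 0 x : ℂ) - Complex.I * (fermiMatsubara β a : ℂ))⁻¹‖ ≤ β / Real.pi := by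
  have h := klfs_frameSymbol_norm_le hβ μ 0 a x
  have ha := half_le_abs_int_add_half a
  have hpos := klsf_abs_add_half_pos a
  calc _ ≤ β / (2 * Real.pi) / |(a : ℝ) + 1 / 2| := h
    _ ≤ β / (2 * Real.pi) / (1 / 2) := by
        exact div_le_div_of_nonneg_left (by positivity) (by norm_num) ha
    _ = β / Real.pi := by field_simp

/-- **The one-loop average `A₂ = (βL²)⁻¹ Σ_q ĝ₀(q)²` is bounded and converges** eventually in `L` then in `M` (iterated Tannery over
the moving Matsubara window, domination `(β/2π)²/|n+½|²`, per-integer Riemann sums of the continuous periodic `(g₀ n)²`). -/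
theorem sqAvg_iterLimit {β : ℝ} (hβ : 0 < β) (μ : ℝ) :
    ∃ aInf : ℂ, ∃ A : ℝ,
      (∀ (L : ℕ) [NeZero L] (M : ℕ) [NeZero M], ‖(∑ q : FreqMomentum L M, propCT L M β μ 0 q ^ 2) / ((β * (L : ℝ) ^ 2 : ℝ) : ℂ)‖ ≤ A) ∧
      (∀ ε : ℝ, 0 < ε → ∃ L₁ : ℕ, ∀ (L : ℕ) [NeZero L], L₁ ≤ L → ∃ M₁ : ℕ, ∀ (M : ℕ) [NeZero M], M₁ ≤ M →
        ‖(∑ q : FreqMomentum L M, propCT L M β μ 0 q ^ 2) / ((β * (L : ℝ) ^ 2 : ℝ) : ℂ) - aInf‖ ≤ ε) := by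
  -- the bare symbol, the momentum averages of its square, their limits and majorants
  set g : ℤ → (Fin 2 → ℝ) → ℂ := fun a x => ((bandCT μ 0 x : ℂ) - Complex.I * (fermiMatsubara β a : ℂ))⁻¹ with hg
  set F : (L M : ℕ) → MatsubaraIdx M → ℂ := fun L M ω =>
    if h : L = 0 then 0 else
      (haveI : NeZero L := ⟨h⟩
       ((L ^ 2 : ℕ) : ℝ)⁻¹ • ∑ q : TorusSite 2 L, g (matsubaraInt M ω) (latticeMomentum L q) ^ 2) with hF
  set c : ℤ → ℂ := fun n => (((2 * Real.pi) ^ 2)⁻¹ : ℝ) • ∫ q in brillouin 2, g n (fun i => q i + Real.pi) ^ 2 with hc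
  set b : ℤ → ℝ := fun n => (β / (2 * Real.pi)) ^ 2 * (1 / |(n : ℝ) + 1 / 2| ^ (2 : ℝ)) with hb
  have hb_summ : Summable b := ((Real.summable_one_div_int_add_rpow (1 / 2) 2).2 (by norm_num)).mul_left _
  have hg_norm : ∀ (n : ℤ) (x : Fin 2 → ℝ), ‖g n x ^ 2‖ ≤ b n := by
    intro n x
    rw [norm_pow, hb]
    simp only [Real.rpow_two]
    have h := klfs_frameSymbol_norm_le hβ μ 0 n x
    have hpos := klsf_abs_add_half_pos n
    calc ‖g n x‖ ^ 2 ≤ (β / (2 * Real.pi) / |(n : ℝ) + 1 / 2|) ^ 2 := pow_le_pow_left₀ (norm_nonneg _) h 2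
      _ = (β / (2 * Real.pi)) ^ 2 * (1 / |(n : ℝ) + 1 / 2| ^ 2) := by field_simp
  have hF_eq : ∀ (L : ℕ) [NeZero L] (M : ℕ) (ω : MatsubaraIdx M),
      F L M ω = ((L ^ 2 : ℕ) : ℝ)⁻¹ • ∑ q : TorusSite 2 L, g (matsubaraInt M ω) (latticeMomentum L q) ^ 2 := by
    intro L _ M ω
    rw [hF]
    simp only [dif_neg (NeZero.ne L)]
  -- the average as `(1/β) Σ_ω F`
  have hA2 : ∀ (L : ℕ) [NeZero L] (M : ℕ),
      (∑ q : FreqMomentum L M, propCT L M β μ 0 q ^ 2) / ((β * (L : ℝ) ^ 2 : ℝ) : ℂ) =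
        ((1 / β : ℝ) : ℂ) * ∑ ω : MatsubaraIdx M, F L M ω := by
    intro L _ M
    have hL : ((L : ℝ) : ℂ) ≠ 0 := by exact_mod_cast NeZero.ne L
    have hβ' : ((β : ℝ) : ℂ) ≠ 0 := by exact_mod_cast hβ.ne'
    rw [Fintype.sum_prod_type, Finset.sum_div, Finset.mul_sum]
    refine Finset.sum_congr rfl fun ω _ => ?_
    rw [hF_eq, Finset.sum_div, Complex.real_smul, Finset.mul_sum, Finset.mul_sum]
    refine Finset.sum_congr rfl fun q _ => ?_
    rw [propCT_zero_eq_bareSymbol, hg]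
    push_cast
    field_simp
  -- domination
  have hdom : ∀ L, 1 ≤ L → ∀ M, (fun _ : ℕ => 0) L ≤ M → ∀ ω : MatsubaraIdx M, ‖F L M ω‖ ≤ b (matsubaraInt M ω) := by
    intro L hL M _ ω
    haveI : NeZero L := ⟨by omega⟩
    rw [hF_eq]
    exact norm_momentumAverage_le fun q => hg_norm _ _
  -- per-integer limits (Riemann sums; no `M`-dependence)
  have hlim : ∀ n : ℤ, ∀ ε : ℝ, 0 < ε → ∃ L₁ : ℕ, ∀ L, L₁ ≤ L → ∃ M₁ : ℕ, ∀ M, M₁ ≤ M →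
      ∀ ω : MatsubaraIdx M, matsubaraInt M ω = n → ‖F L M ω - c n‖ ≤ ε := by
    intro n ε hε
    have hcont : ContinuousOn (fun x : Fin 2 → ℝ => g n x ^ 2) (Set.pi Set.univ fun _ : Fin 2 => Set.Icc (0 : ℝ) (2 * Real.pi)) :=
      ((klfs_frameSymbol_continuous hβ μ 0 n).pow 2).continuousOn
    obtain ⟨L₀, hL₀⟩ := momentumAverage_approx_allSides (d := 2) hcont hε
    refine ⟨max L₀ 1, fun L hL => ⟨0, fun M _ ω hω => ?_⟩⟩
    haveI : NeZero L := ⟨by have := le_trans (le_max_right _ _) hL; omega⟩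
    rw [hF_eq, hω, hc]
    exact hL₀ L (le_trans (le_max_left _ _) hL)
  have htan := iterated_matsubara_tannery_mul (((1 / β : ℝ) : ℂ)) F c b hb_summ 1 (fun _ => 0) hdom hlim
  refine ⟨((1 / β : ℝ) : ℂ) * ∑' n : ℤ, c n, 1 / β * ∑' n : ℤ, b n, ?_, ?_⟩
  · -- the uniform bound
    intro L _ M _
    rw [hA2, norm_mul, Complex.norm_real, Real.norm_of_nonneg (by positivity : (0 : ℝ) ≤ 1 / β)]
    refine mul_le_mul_of_nonneg_left ?_ (by positivity)
    have hb0 : ∀ n, 0 ≤ b n := fun n => by rw [hb]; positivity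
    calc ‖∑ ω : MatsubaraIdx M, F L M ω‖ ≤ ∑ ω : MatsubaraIdx M, ‖F L M ω‖ := norm_sum_le _ _
      _ ≤ ∑ ω : MatsubaraIdx M, b (matsubaraInt M ω) :=
          Finset.sum_le_sum fun ω _ => hdom L (Nat.one_le_iff_ne_zero.2 (NeZero.ne L)) M (Nat.zero_le _) ω
      _ = ∑ n ∈ Finset.Ico (-(M : ℤ)) M, b n := sum_matsubaraIdx_eq_sum_Ico M b
      _ ≤ ∑' n : ℤ, b n := hb_summ.sum_le_tsum _ fun n _ => hb0 n
  · -- the iterated limit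
    intro ε hε
    obtain ⟨L₁, hL₁⟩ := htan ε hε
    refine ⟨L₁, fun L _ hL => ?_⟩
    obtain ⟨M₁, hM₁⟩ := hL₁ L hL
    refine ⟨M₁, fun M _ hM => ?_⟩
    rw [hA2]
    exact hM₁ M hM

/-! ## §3 The order-`U²` rung of the true carrier satisfies the volume-limit text -/

/-- **THE ORDER-`U²` RUNG OF THE TRUE CARRIER IS WITNESS-PRESENT**: for every `β > 0`, `μ`, frame `K` and thresholds `Mstar`, the second
`U`-derivative of the VL carrier, `S₂(L,M;k,σ) = d²/dU²|₀ klSelfEnergy L M β U μ K klE0 (nScales β + 1) k σ` (`= iteratedDeriv 2 … 0`),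
satisfies the three clauses of `FinalTwoLegVolLimit` verbatim: a momentum-continuous limit per Matsubara integer, a volume-uniform bound,
and grid convergence eventually in `L` then in `M`, uniformly on the momentum grid. -/
theorem secondOrder_volLimit {β : ℝ} (hβ : 0 < β) (μ : ℝ) (K : TrigPolyC4v) (Mstar : ℕ → ℕ) :
    ∃ sigmaInf : ℤ → (Fin 2 → ℝ) → Fin 2 → ℂ, ∃ B : ℝ, ∃ L₀ : ℕ,
      (∀ (n : ℤ) (σ : Fin 2), Continuous fun p : Fin 2 → ℝ => sigmaInf n p σ) ∧
      (∀ (L : ℕ) [NeZero L], L₀ ≤ L → ∀ (M : ℕ) [NeZero M], Mstar L ≤ M →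
        ∀ (k : FreqMomentum L M) (σ : Fin 2),
          ‖deriv (deriv fun U : ℝ => klSelfEnergy L M β U μ K klE0 (nScales β + 1) k σ) 0‖ ≤ B) ∧
      (∀ (n : ℤ) (σ : Fin 2) (ε : ℝ), 0 < ε → ∃ L₁ : ℕ, ∀ (L : ℕ) [NeZero L], L₁ ≤ L →
        ∃ M₁ : ℕ, ∀ (M : ℕ) [NeZero M], M₁ ≤ M → ∀ ω : MatsubaraIdx M, matsubaraInt M ω = n →
          ∀ k : TorusSite 2 L,
            ‖deriv (deriv fun U : ℝ => klSelfEnergy L M β U μ K klE0 (nScales β + 1) (ω, k) σ) 0 -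
                sigmaInf n (latticeMomentum L k) σ‖ ≤ ε) := by
  -- the continuum symbols: the frame dressing `ĝ₀/ĝ_K` and the bare propagator `ĝ₀`
  set ωn : ℤ → ℝ := fun n => Real.pi * (2 * (n : ℝ) + 1) / β with hωn
  set dress : ℤ → (Fin 2 → ℝ) → ℂ := fun n p =>
    (-Complex.I * (ωn n : ℂ) + ((-2 * ∑ i, Real.cos (p i) - μ - K.eval p : ℝ) : ℂ)) /
      (-Complex.I * (ωn n : ℂ) + ((-2 * ∑ i, Real.cos (p i) - μ : ℝ) : ℂ)) with hdress
  set g0 : ℤ → (Fin 2 → ℝ) → ℂ := fun n p => ((bandCT μ 0 p : ℂ) - Complex.I * (fermiMatsubara β n : ℂ))⁻¹ with hg0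
  set Bd : ℝ := 1 + K.coeffNorm 0 * (β / Real.pi) with hBd
  have hBd0 : 0 ≤ Bd := by
    have := TrigPolyC4v.coeffNorm_nonneg 0 K
    positivity
  have hωn_abs : ∀ n : ℤ, Real.pi / β ≤ |ωn n| := fun n => by
    rw [hωn]; dsimp only
    rw [abs_div, abs_of_pos hβ, abs_mul, abs_of_pos Real.pi_pos]
    exact div_le_div_of_nonneg_right (le_mul_of_one_le_right Real.pi_pos.le (one_le_abs_two_mul_add_one n)) hβ.le
  have hdress_cont : ∀ n : ℤ, Continuous (dress n) := by
    intro n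
    have hden : ∀ p : Fin 2 → ℝ, -Complex.I * (ωn n : ℂ) + ((-2 * ∑ i, Real.cos (p i) - μ : ℝ) : ℂ) ≠ 0 := by
      intro p h
      have := congrArg Complex.im h
      simp at this
      have h' := hωn_abs n
      have hπβ : 0 < Real.pi / β := div_pos Real.pi_pos hβ
      rw [this, abs_zero] at h'
      linarith
    have hcos : Continuous fun p : Fin 2 → ℝ => -2 * ∑ i, Real.cos (p i) - μ :=
      ((continuous_const.mul (continuous_finsetSum _ fun i _ =>
        Real.continuous_cos.comp (continuous_apply i))).sub continuous_const)
    have hK : Continuous fun p : Fin 2 → ℝ => K.eval p := TrigPolyC4v.continuous_eval K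
    refine Continuous.div ?_ ?_ hden
    · exact continuous_const.add (Complex.continuous_ofReal.comp (hcos.sub hK))
    · exact continuous_const.add (Complex.continuous_ofReal.comp hcos)
  have hdress_bd : ∀ (n : ℤ) (p : Fin 2 → ℝ), ‖dress n p‖ ≤ Bd := fun n p => norm_dressing_le hβ μ K _ (hωn_abs n) p
  have hdress_grid : ∀ (L M : ℕ) [NeZero L] (ω : MatsubaraIdx M) (k : TorusSite 2 L),
      propCT L M β μ 0 (ω, k) / propCT L M β μ K (ω, k) = dress (matsubaraInt M ω) (latticeMomentum L k) := by
    intro L M _ ω k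
    rw [propCT_zero_div_propCT_eq_band hβ.ne', matsubaraFreq_of_matsubaraInt_eq β rfl]
  have hg0_cont : ∀ n : ℤ, Continuous (g0 n) := fun n => klfs_frameSymbol_continuous hβ μ 0 n
  have hg0_bd : ∀ (n : ℤ) (p : Fin 2 → ℝ), ‖g0 n p‖ ≤ β / Real.pi := fun n p => norm_bareSymbol_le hβ μ n p
  have hg0_grid : ∀ (L M : ℕ) [NeZero L] (ω : MatsubaraIdx M) (k : TorusSite 2 L),
      propCT L M β μ 0 (ω, k) = g0 (matsubaraInt M ω) (latticeMomentum L k) := fun L M _ ω k =>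
    propCT_zero_eq_bareSymbol β μ ω k
  -- the three volume-limit inputs: the sunset average, the tadpole average, the one-loop average
  obtain ⟨sig₁, B₁, L₁', hc₁, hb₁, hl₁⟩ := sunsetSum_volLimit hβ μ Mstar
  obtain ⟨aInf, hla⟩ := tadpoleAvg_iterLimit hβ μ
  have hba : ∀ (L : ℕ) [NeZero L] (M : ℕ) [NeZero M],
      ‖(∑ q : FreqMomentum L M, propCT L M β μ 0 q) / ((β * (L : ℝ) ^ 2 : ℝ) : ℂ)‖ ≤ 1 / 2 := fun L _ M _ =>
    norm_tadpoleAvg_le hβ μ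
  obtain ⟨a₂Inf, A₂, hb₂, hl₂⟩ := sqAvg_iterLimit hβ μ
  -- the two scalar products and their momentum-constant families
  obtain ⟨hbP₁, hlP₁⟩ := iterLimit_mul (by norm_num : (0 : ℝ) ≤ 1 / 2) hba hla hba hla
  obtain ⟨hbP₂, hlP₂⟩ := iterLimit_mul (by norm_num : (0 : ℝ) ≤ 1 / 2) hba hla hb₂ hl₂
  obtain ⟨hcQ₁, hbQ₁, hlQ₁⟩ := volLimitShape_of_scalar Mstar hbP₁ hlP₁
  obtain ⟨hcQ₂, hbQ₂, hlQ₂⟩ := volLimitShape_of_scalar Mstar hbP₂ hlP₂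
  -- the three dressed terms
  have hB1 : 0 ≤ B₁ := by
    haveI : NeZero (L₁' + 1) := ⟨by omega⟩
    haveI : NeZero (Mstar (L₁' + 1) + 1) := ⟨by omega⟩
    have h := hb₁ (L₁' + 1) (by omega) (Mstar (L₁' + 1) + 1) (by omega)
      ((⟨0, by omega⟩ : MatsubaraIdx (Mstar (L₁' + 1) + 1)), fun _ => 0) 0
    exact (norm_nonneg _).trans h
  obtain ⟨hcT₁, hbT₁, hlT₁⟩ := volLimitShape_dressing_mul (Mstar := Mstar)
    (Φ := fun L M _ _ k => (2 : ℂ) * (propCT L M β μ 0 k / propCT L M β μ K k) ^ 2)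
    (φ := fun n p => (2 : ℂ) * dress n p ^ 2) (Bφ := 2 * Bd ^ 2) (by positivity)
    (fun n => continuous_const.mul ((hdress_cont n).pow 2))
    (fun n p => by
      rw [norm_mul, norm_pow, Complex.norm_ofNat]
      exact mul_le_mul_of_nonneg_left (pow_le_pow_left₀ (norm_nonneg _) (hdress_bd n p) 2) (by norm_num))
    (fun L M _ _ ω k => by simp only [hdress_grid]) hc₁ hb₁ hl₁
  obtain ⟨hcT₂, hbT₂, hlT₂⟩ := volLimitShape_dressing_mul (Mstar := Mstar)
    (Φ := fun L M _ _ k => -(2 : ℂ) * (propCT L M β μ 0 k / propCT L M β μ K k) ^ 2 * propCT L M β μ 0 k)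
    (φ := fun n p => -(2 : ℂ) * dress n p ^ 2 * g0 n p) (Bφ := 2 * Bd ^ 2 * (β / Real.pi)) (by positivity)
    (fun n => (continuous_const.mul ((hdress_cont n).pow 2)).mul (hg0_cont n))
    (fun n p => by
      rw [norm_mul, norm_mul, norm_neg, norm_pow, Complex.norm_ofNat]
      exact mul_le_mul (mul_le_mul_of_nonneg_left (pow_le_pow_left₀ (norm_nonneg _) (hdress_bd n p) 2) (by norm_num))
        (hg0_bd n p) (norm_nonneg _) (by positivity))
    (fun L M _ _ ω k => by rw [hdress_grid, hg0_grid]) hcQ₁ hbQ₁ hlQ₁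
  obtain ⟨hcT₃, hbT₃, hlT₃⟩ := volLimitShape_dressing_mul (Mstar := Mstar)
    (Φ := fun L M _ _ k => -(2 : ℂ) * (propCT L M β μ 0 k / propCT L M β μ K k) ^ 2)
    (φ := fun n p => -(2 : ℂ) * dress n p ^ 2) (Bφ := 2 * Bd ^ 2) (by positivity)
    (fun n => continuous_const.mul ((hdress_cont n).pow 2))
    (fun n p => by
      rw [norm_mul, norm_neg, norm_pow, Complex.norm_ofNat]
      exact mul_le_mul_of_nonneg_left (pow_le_pow_left₀ (norm_nonneg _) (hdress_bd n p) 2) (by norm_num))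
    (fun L M _ _ ω k => by simp only [hdress_grid]) hcQ₂ hbQ₂ hlQ₂
  -- their sum
  obtain ⟨hcU, hbU, hlU⟩ := volLimitShape_add hcT₁ hbT₁ hlT₁ hcT₂ hbT₂ hlT₂
  obtain ⟨hcV, hbV, hlV⟩ := volLimitShape_add hcU hbU hlU hcT₃ hbT₃ hlT₃
  -- the carrier IS that sum
  have hform : ∀ (L : ℕ) [NeZero L] (M : ℕ) (k : FreqMomentum L M) (σ : Fin 2),
      deriv (deriv fun U : ℝ => klSelfEnergy L M β U μ K klE0 (nScales β + 1) k σ) 0 =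
        (2 : ℂ) * (propCT L M β μ 0 k / propCT L M β μ K k) ^ 2 *
            ((∑ k₂ : FreqMomentum L M, ∑ k₃ : FreqMomentum L M, ∑ k₄ : FreqMomentum L M,
                if matsubaraInt M k.1 + matsubaraInt M k₃.1 = matsubaraInt M k₂.1 + matsubaraInt M k₄.1 ∧ k.2 + k₃.2 = k₂.2 + k₄.2 then
                  propCT L M β μ 0 k₂ * propCT L M β μ 0 k₃ * propCT L M β μ 0 k₄ else 0) /
              ((β * (L : ℝ) ^ 2 : ℝ) : ℂ) ^ 2) +
          -(2 : ℂ) * (propCT L M β μ 0 k / propCT L M β μ K k) ^ 2 * propCT L M β μ 0 k *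
            ((∑ q : FreqMomentum L M, propCT L M β μ 0 q) / ((β * (L : ℝ) ^ 2 : ℝ) : ℂ) *
              ((∑ q : FreqMomentum L M, propCT L M β μ 0 q) / ((β * (L : ℝ) ^ 2 : ℝ) : ℂ))) +
          -(2 : ℂ) * (propCT L M β μ 0 k / propCT L M β μ K k) ^ 2 *
            ((∑ q : FreqMomentum L M, propCT L M β μ 0 q) / ((β * (L : ℝ) ^ 2 : ℝ) : ℂ) *
              ((∑ q : FreqMomentum L M, propCT L M β μ 0 q ^ 2) / ((β * (L : ℝ) ^ 2 : ℝ) : ℂ))) := by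
    intro L _ M k σ
    rw [(hasDerivAt_deriv_klSelfEnergy_nScales_succ_zero_eval hβ μ K k σ).deriv]
    have hβL : ((β * (L : ℝ) ^ 2 : ℝ) : ℂ) ≠ 0 := by
      have hL : (L : ℝ) ≠ 0 := by exact_mod_cast NeZero.ne L
      exact_mod_cast mul_ne_zero hβ.ne' (pow_ne_zero 2 hL)
    field_simp
    ring
  exact ⟨_, _, _, hcV,
    fun L _ hL M _ hM k σ => by
      rw [hform]
      exact hbV L hL M hM k σ,
    fun n σ ε hε => by
      obtain ⟨L₁, hL₁⟩ := hlV n σ ε hε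
      refine ⟨L₁, fun L _ hL => ?_⟩
      obtain ⟨M₁, hM₁⟩ := hL₁ L hL
      refine ⟨M₁, fun M _ hM ω hω k => ?_⟩
      rw [hform]
      exact hM₁ M hM ω hω k⟩

end Summit.HubbardSuperconductivity.HubbardSuperconductivity.Theorems.TwoPointAssembly

end
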